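import Summits.QuantumFields.YangMills.Theses.BackwardLiouvilleRigidity
import Summits.QuantumFields.YangMills.Theorems.BackwardLiouvilleRigidityFlatRatioTerminationInnerWindowGaugeSmall
import Summits.QuantumFields.YangMills.Theorems.BackwardLiouvilleRigidityFlatRatioTerminationGaugeSmallChains
import Summits.QuantumFields.YangMills.Theorems.BackwardLiouvilleRigidityFlatRatioTerminationThresholds
import Summits.QuantumFields.YangMills.Theorems.BackwardLiouvilleRigidityFlatRatioTerminationWindowTV
import Summits.QuantumFields.YangMills.Theorems.BackwardLiouvilleRigidityFlatRatioTerminationPushToZero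

/-!
# Route `BackwardLiouvilleRigidity`, support item `FlatRatioTermination` (stmt-QuantumFields-22542) — PROVED

The planner's (ym-r3-idea-1 g10) registered skeleton `Cruxes/FluctuationComparisonRegPrIntL/Lines/flat_ratio_termination.lean`
(sha 6f6fdb21) composed five stubs into `Theses.BackwardLiouvilleRigidity.FlatRatioTermination`; all five are now tree theorems:
`stub_innerWindowGaugeSmall` (p679507, the volume-uniform small SU(2) gauge via the CW-skeleton / cone-extension construction),
`stub_gaugeSmallChains` (p651934), `stub_thresholds` (p652443), `stub_windowTV` (p647765), `stub_pushToZero` (p647387).  This file is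
the composition, verbatim from the skeleton: `innerWindowChains` (inner window ⇒ one-bond chains of length `≤ #PBond²` inside the
window) and `flatRatioTermination_proof`.

HONEST SCOPE.  A SUPPORT item (the decaying-defect termination of the backward-Liouville line) is closed; the route's cruxes
`OneStepBackwardContraction` / `BackwardChainLemma` / `ClassLimitTrajectories`, the organ `BackwardStabilityAdm`, rung R3 (RECORD rung)
and every summit statement stay OPEN; `YM3TorusSU2` and the Yang–Mills mass gap are NOT proved by any of this.
-/

namespace Summit.QuantumFields.YangMills.Theorems.FlatRatioTermination

open Filter Topology MeasureTheory
open Literature.MathematicalPhysics.QuantumFieldTheory.Balaban1983to89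
open Literature.MathematicalPhysics.QuantumFieldTheory.Balaban1983to89.T3ContinuumYM3Torus
open Literature.MathematicalPhysics.QuantumFieldTheory.Balaban1983to89.T3NestedUnitLaws
open Literature.MathematicalPhysics.QuantumFieldTheory.Balaban1983to89.T3UnitLawDensityEML
open Literature.MathematicalPhysics.QuantumFieldTheory.Balaban1983to89.T3UnitScaleTilt

/-- THE INNER-WINDOW CHAIN LEMMA (the skeleton's derived `innerWindowChains`, now a theorem: `stub_innerWindowGaugeSmall` (p679507) +
`stub_thresholds` (p652443) + `stub_gaugeSmallChains` (p651934)): from some height on every configuration of the inner window is joined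
to `1` by `≤ #PBond_j²` one-bond moves inside the window. [folklore] -/
theorem innerWindowChains : open MeasureTheory Filter Topology Literature.MathematicalPhysics.QuantumFieldTheory.Balaban1983to89 T3ContinuumYM3Torus T3NestedUnitLaws T3UnitLawDensityEML T4Continuum BalabanUVClass T3UnitScaleTilt in ∃ pW : ℝ, ∀ (p₀ : ℝ), pW ≤ p₀ → ∀ (F : T3Family) (γ b₀ : ℝ), 0 < γ → γ ≤ 1 → 0 < b₀ → ∃ jW : ℕ, ∀ j : ℕ, jW ≤ j → (∀ U : GaugeField (F.P j) 0 ↥(Matrix.specialUnitaryGroup (Fin 2) ℂ), PlaqSmall (θBal F.L γ (Real.sqrt b₀) (p₀ / 2) j) U → ∃ (n : ℕ) (W : ℕ → GaugeField (F.P j) 0 ↥(Matrix.specialUnitaryGroup (Fin 2) ℂ)), n ≤ Fintype.card (PBond (F.P j) 0) ^ 2 ∧ (∀ e, W 0 e = 1) ∧ W n = U ∧ (∀ i, i ≤ n → PlaqSmall (θBal F.L γ b₀ p₀ j) (W i)) ∧ (∀ i, i < n → ∃ b : PBond (F.P j) 0, ∀ e, e ≠ b → W i e = W (i + 1) e)) :=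 by
  classical
  obtain ⟨pW₁, h₁⟩ := stub_innerWindowGaugeSmall
  obtain ⟨pW₂, h₂⟩ := stub_thresholds
  refine ⟨max pW₁ pW₂, fun p₀ hp F γ b₀ hγ hγ1 hb₀ => ?_⟩
  obtain ⟨jW₁, hj₁⟩ := h₁ p₀ ((le_max_left _ _).trans hp) F γ b₀ hγ hγ1 hb₀
  obtain ⟨jW₂, hj₂⟩ := h₂ p₀ ((le_max_right _ _).trans hp) F γ b₀ hγ hγ1 hb₀
  refine ⟨max jW₁ jW₂, fun j hj U hU => ?_⟩
  obtain ⟨hη, hη4, hδ, hbud⟩ := hj₂ j ((le_max_right _ _).trans hj)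
  have hθin : 0 ≤ Literature.MathematicalPhysics.QuantumFieldTheory.Balaban1983to89.T3UnitScaleTilt.θBal F.L γ (Real.sqrt b₀) (p₀ / 2) j :=
    (Literature.MathematicalPhysics.QuantumFieldTheory.Balaban1983to89.T3MinimiserStabilityReduction.θBal_pos F.hL.2.le hγ hγ1
      (Real.sqrt_pos.mpr hb₀) _ _).le
  exact stub_gaugeSmallChains F j _ _ _ hη hη4 hθin hδ hbud U hU (hj₁ j ((le_max_left _ _).trans hj) U hU)

/-- **`FlatRatioTermination` (stmt-QuantumFields-22542, support item of route-QuantumFields-BackwardLiouvilleRigidity, rev 4) HOLDS**: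
the planner's kernel-checked composition `flatRatioTermination_of_stubs` of `Lines/flat_ratio_termination.lean` with all five registered
stubs now tree theorems (`innerWindowChains` above, `stub_windowTV` p647765, `stub_pushToZero` p647387). [folklore] -/
theorem flatRatioTermination_proof : Summit.QuantumFields.YangMills.Theses.BackwardLiouvilleRigidity.FlatRatioTermination := by
  classical
  obtain ⟨pW, hW⟩ := innerWindowChains
  refine ⟨pW, 1, one_pos, ?_⟩
  intro F γ hγ hγ1 b₀ p₀ κ j₀ prm ω η hp hb₀ hκ hpos hη μ μ' ρ ρ' hc hc' hB hIn hosc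
  obtain ⟨jW, hjW⟩ := hW p₀ hp F γ b₀ hγ hγ1 hb₀
  obtain ⟨j₁, hj₀₁, τ, hτ, hlim⟩ := hosc
  refine stub_pushToZero F μ μ' hc hc' ?_
  intro ε hε
  obtain ⟨δ₀, hδ₀, hT⟩ := stub_windowTV ε hε
  have hη0 : Tendsto η atTop (𝓝 0) := hη.tendsto_atTop_zero
  obtain ⟨N₁, hN₁⟩ := eventually_atTop.mp (hlim.eventually (gt_mem_nhds hδ₀))
  obtain ⟨N₂, hN₂⟩ := eventually_atTop.mp (hη0.eventually (gt_mem_nhds hδ₀))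
  set j : ℕ := max (max j₀ j₁) (max jW (max N₁ N₂)) with hjdef
  have hj₀ : j₀ ≤ j := (le_max_left _ _).trans (le_max_left _ _)
  have hj₁ : j₁ ≤ j := (le_max_right _ _).trans (le_max_left _ _)
  have hjWj : jW ≤ j := (le_max_left _ _).trans (le_max_right _ _)
  have hN₁j : N₁ ≤ j := ((le_max_left _ _).trans (le_max_right _ _)).trans (le_max_right _ _)
  have hN₂j : N₂ ≤ j := ((le_max_right _ _).trans (le_max_right _ _)).trans (le_max_right _ _)
  refine ⟨j, ?_⟩
  obtain ⟨hposj, hd, hd', -, -, -, -, -, -⟩ := hB j hj₀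
  have hθin : 0 < Literature.MathematicalPhysics.QuantumFieldTheory.Balaban1983to89.T3UnitScaleTilt.θBal F.L γ (Real.sqrt b₀) (p₀ / 2) j :=
    Literature.MathematicalPhysics.QuantumFieldTheory.Balaban1983to89.T3MinimiserStabilityReduction.θBal_pos F.hL.2.le hγ hγ1 (Real.sqrt_pos.mpr hb₀) _ _
  have hτD : max (τ j) 0 * ((Fintype.card (Literature.MathematicalPhysics.QuantumFieldTheory.Balaban1983to89.PBond (F.P j) 0) ^ 2 : ℕ) : ℝ) ≤ δ₀ := by
    have h1 := hN₁ j hN₁j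
    rcases le_or_gt (τ j) 0 with hneg | hposτ
    · rw [max_eq_right hneg, zero_mul]; exact hδ₀.le
    · rw [max_eq_left hposτ.le]; push_cast; exact h1.le
  refine hT F j _ _ _ (max (τ j) 0) (η j) hθin (le_max_right _ _) hτD (hpos j).2 (hN₂ j hN₂j).le (μ j) (μ' j) (ρ j) (ρ' j) (hc j).1 (hc' j).1 hposj hd hd' (hjW j hjWj) ?_ (hIn j hj₀).1 (hIn j hj₀).2
  intro b U V hU hV hUV
  exact (hτ j hj₁ b U V hU hV hUV).trans (le_max_left _ _)

end Summit.QuantumFields.YangMills.Theorems.FlatRatioTermination
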